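import Literature.ModelTheory.ExponentialFields.OEFDefinablyCompleteZeros
import Literature.ModelTheory.ExponentialFields.OMinimalOfModelComplete
import HarnessLib

/-!
# Sign sets of one-variable exponential polynomials in the models of `OEF ∪ [DC]` are finite unions of intervals

Topic `Literature/ModelTheory/ExponentialFields`.  O-minimality of a recursive subtheory of
`Th(ℝ_exp)` (Berarducci–Servi 2004, Cor. 2.5: "a recursively axiomatized subtheory `T_omin`
such that all the models are o-minimal"; Fornasiero–Servi 2010, Thm. 8.2 / Cor. 8.3 for
`[OF] + [DCB] + [exp' = exp]`) is the semantic engine of the Fornasiero–Servi / Jones–Servi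
route to Macintyre–Wilkie's theorem.  This file proves its first instance *from the axioms*
`OEFDC = OEF ∪ [DC]` (`OEFDefinablyCompleteZeros.lean`): in every model, the sets defined by the
atomic formulas `F(x) = 0`, `F(x) > 0` (and their Boolean combinations), `F` a one-variable
exponential polynomial `Σ_{j<n} P_j(x) exp(x)^j` with parameters, are finite unions of points and
open intervals — Fornasiero–Servi's criterion "γ(A) < ∞ for quantifier free definable `A`"
(2010, Thm. 7.7) in dimension one for this fragment.

* **`IsDefinablyComplete.isFiniteUnionOfIntervals_setOf_pos`** — the general principle: in a
  definably complete ordered field with `<`, `+` definable, a continuous function with definable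
  graph and finitely many zeros is positive exactly on a finite union of intervals (definable
  intermediate value theorem, `DefinablyCompleteIntervals.lean`, between consecutive zeros; the
  combinatorics is `isFiniteUnionOfIntervals_of_cells` of `OMinimalOfModelComplete.lean`; the
  real case is `isFiniteUnionOfIntervals_setOf_pos` of `RealExpFieldProofs.lean`);
* **`OEFModel.isFiniteUnionOfIntervals_setOf_unaryExpPoly_pos`** /
  `…_eq_zero` / `…_nonneg` and the `OEFDCModel` versions — for *every* coefficient family `P`
  (if all `P_j = 0` the sets are `∅` or everything), by the finiteness theorem
  `OEFModel.finite_setOf_unaryExpPoly_eq_zero`.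

Everything is proved; nothing here is a named fact.

## References

* A. Fornasiero, T. Servi, *Definably complete Baire structures*, Fund. Math. 209 (2010),
  Theorem 7.7, Theorem 8.2, Corollary 8.3. [FornasieroServi2010]
* A. Berarducci, T. Servi, Ann. Pure Appl. Logic 125 (2004), Corollary 2.5. [BerarducciServi2004]
* L. van den Dries, *Tame topology and o-minimal structures* (1998), Ch. 1 (3.2), Ch. 2 (2.11).
  [Dries1998]
-/

noncomputable section

open Set FirstOrder FirstOrder.Language FirstOrder.Language.Structure Polynomial
open _root_.Filter _root_.Topology

namespace Literature.ModelTheory.ExponentialFields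

open OMinimalOfModelComplete

universe u v w

/-! ### Continuous definable functions with finitely many zeros have tame sign sets -/

section SignSets

variable {K : Type*} [Field K] [LinearOrder K] [IsStrictOrderedRing K] [TopologicalSpace K]
  [OrderTopology K] {L : FirstOrder.Language.{u, v}} [L.Structure K] {f : K → K}

/-- Between two points in the same cell of the zeros of a continuous definable `f`, the sign of
`f` does not change from `+` (definable intermediate value theorem). [folklore] -/
theorem _root_.FirstOrder.Language.IsDefinablyComplete.pos_of_sameCell_zeros
    (hDC : L.IsDefinablyComplete K)
    (hlt : (univ : Set K).Definable L {v : Fin 2 → K | v 0 < v 1})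
    (hadd : (univ : Set K).Definable L {v : Fin 3 → K | v 2 = v 0 + v 1})
    (hf : (univ : Set K).Definable L {v : Fin 2 → K | v 1 = f (v 0)})
    (hcont : Continuous f) {N : ℕ} {b : Fin N → K} (hb : ∀ z, f z = 0 → ∃ i, b i = z)
    {x x' : K} (hcell : SameCell b x x') (hx : 0 < f x) : 0 < f x' := by
  by_contra hx'
  push Not at hx'
  rcases lt_trichotomy x x' with hlt' | heq | hgt
  · -- `x < x'`, `f x > 0 ≥ f x'`: a zero of `-f` in `[x, x']`, necessarily `> x`
    obtain ⟨c, hc, hfc⟩ := hDC.exists_mem_Icc_eq_of_continuousOn hlt (definable_graph_neg hadd hf)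
      hlt'.le hcont.neg.continuousOn (y := 0) (by simpa using hx.le) (by simpa using hx')
    have hfc0 : f c = 0 := by simpa using hfc
    obtain ⟨i, hi⟩ := hb c hfc0
    have hxc : x < c := lt_of_le_of_ne hc.1 fun h => hx.ne' (by rw [h, hfc0])
    have h1 : x' ≤ b i := (hcell i).1.1 (by rw [hi]; exact hxc.le)
    have h2 : b i ≤ x := (hcell i).2.2 (by rw [hi]; exact hc.2)
    rw [hi] at h1 h2
    exact (lt_irrefl x) (hxc.trans_le h2)
  · rw [← heq] at hx'
    exact (not_le.2 hx) hx'
  · -- `x' < x`, `f x' ≤ 0 < f x`: a zero of `f` in `[x', x]`, necessarily `< x`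
    obtain ⟨c, hc, hfc0⟩ := hDC.exists_mem_Icc_eq_of_continuousOn hlt hf hgt.le
      hcont.continuousOn (y := 0) hx' hx.le
    obtain ⟨i, hi⟩ := hb c hfc0
    have hcx : c < x := lt_of_le_of_ne hc.2 fun h => hx.ne' (by rw [← h, hfc0])
    have h1 : b i ≤ x' := (hcell i).2.1 (by rw [hi]; exact hcx.le)
    have h2 : x ≤ b i := (hcell i).1.2 (by rw [hi]; exact hc.1)
    rw [hi] at h1 h2
    exact (lt_irrefl x) (h2.trans_lt hcx)

/-- **A continuous definable function with finitely many zeros is positive on a finite union of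
intervals** (definably complete ordered field, `<` and `+` definable): the zeros cut the line
into finitely many cells on each of which the sign is constant (van den Dries 1998, Ch. 2,
proof of (2.11), there for polynomials over `ℝ`). [cite: Dries1998, Ch. 2 (2.11)] -/
theorem _root_.FirstOrder.Language.IsDefinablyComplete.isFiniteUnionOfIntervals_setOf_pos
    (hDC : L.IsDefinablyComplete K)
    (hlt : (univ : Set K).Definable L {v : Fin 2 → K | v 0 < v 1})
    (hadd : (univ : Set K).Definable L {v : Fin 3 → K | v 2 = v 0 + v 1})
    (hf : (univ : Set K).Definable L {v : Fin 2 → K | v 1 = f (v 0)})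
    (hcont : Continuous f) (hfin : {x | f x = 0}.Finite) :
    IsFiniteUnionOfIntervals {x | 0 < f x} := by
  classical
  set Z := hfin.toFinset with hZ
  let b : Fin Z.card → K := fun i => (Z.equivFin.symm i : K)
  have hb : ∀ z, f z = 0 → ∃ i, b i = z := by
    intro z hz
    have hzZ : z ∈ Z := hfin.mem_toFinset.2 hz
    exact ⟨Z.equivFin ⟨z, hzZ⟩, by simp [b]⟩
  refine isFiniteUnionOfIntervals_of_cells b fun x x' hcell => ?_
  have hcell' : SameCell b x' x := fun i => ⟨(hcell i).1.symm, (hcell i).2.symm⟩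
  exact ⟨hDC.pos_of_sameCell_zeros hlt hadd hf hcont hb hcell,
    hDC.pos_of_sameCell_zeros hlt hadd hf hcont hb hcell'⟩

/-- The same for `{x | f x < 0}` (apply the previous result to `-f`). [cite: Dries1998, Ch. 2 (2.11)] -/
theorem _root_.FirstOrder.Language.IsDefinablyComplete.isFiniteUnionOfIntervals_setOf_neg
    (hDC : L.IsDefinablyComplete K)
    (hlt : (univ : Set K).Definable L {v : Fin 2 → K | v 0 < v 1})
    (hadd : (univ : Set K).Definable L {v : Fin 3 → K | v 2 = v 0 + v 1})
    (hf : (univ : Set K).Definable L {v : Fin 2 → K | v 1 = f (v 0)})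
    (hcont : Continuous f) (hfin : {x | f x = 0}.Finite) :
    IsFiniteUnionOfIntervals {x | f x < 0} := by
  have hfin' : {x | -f x = 0}.Finite := by simpa using hfin
  have h := hDC.isFiniteUnionOfIntervals_setOf_pos hlt hadd (definable_graph_neg hadd hf)
    hcont.neg hfin'
  simpa using h

/-- The same for `{x | 0 ≤ f x}` (complement). [cite: Dries1998, Ch. 2 (2.11)] -/
theorem _root_.FirstOrder.Language.IsDefinablyComplete.isFiniteUnionOfIntervals_setOf_nonneg
    (hDC : L.IsDefinablyComplete K)
    (hlt : (univ : Set K).Definable L {v : Fin 2 → K | v 0 < v 1})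
    (hadd : (univ : Set K).Definable L {v : Fin 3 → K | v 2 = v 0 + v 1})
    (hf : (univ : Set K).Definable L {v : Fin 2 → K | v 1 = f (v 0)})
    (hcont : Continuous f) (hfin : {x | f x = 0}.Finite) :
    IsFiniteUnionOfIntervals {x | 0 ≤ f x} := by
  have h := (hDC.isFiniteUnionOfIntervals_setOf_neg hlt hadd hf hcont hfin).compl
  refine (congrArg _ ?_).mpr h
  ext x
  simp

end SignSets

/-! ### Sign sets of exponential polynomials in definably complete models of `OEF` -/

namespace OEFModel

variable (K : Language.Theory.ModelType.{0, 0, w} Theory.OEF)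

/-- The graph of a one-variable exponential polynomial of a model of `OEF` is definable.
[folklore] -/
theorem definable_graph_unaryExpPoly (P : ℕ → K[X]) (n : ℕ) :
    (univ : Set K).Definable Language.orderedExpRing
      {v : Fin 2 → K | v 1 = UnaryExpPoly.eval exp P n (v 0)} :=
  definable_graph_of_definableFun (g := fun y => UnaryExpPoly.eval exp P n y)
    (UnaryExpPoly.definableFun_eval definable_graph_add definable_graph_mul (definable_graph_exp K)
      P n (definableFun_proj_params 0))

/-- If all coefficients vanish, the exponential polynomial is identically zero. [folklore] -/
theorem unaryExpPoly_eq_zero_of_forall {P : ℕ → K[X]} {n : ℕ} (hP : ∀ j < n, P j = 0) (x : K) :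
    UnaryExpPoly.eval exp P n x = 0 :=
  Finset.sum_eq_zero fun j hj => by rw [hP j (Finset.mem_range.1 hj), eval_zero, zero_mul]

/-- **`{x | Σ_j P_j(x) exp(x)^j > 0}` is a finite union of intervals in every definably complete
model of `OEF`**, for every coefficient family (Fornasiero–Servi 2010, the o-minimality theorem
8.2 in dimension one for this fragment; if all `P_j = 0` the set is empty).
[cite: FornasieroServi2010, Theorem 8.2] -/
theorem isFiniteUnionOfIntervals_setOf_unaryExpPoly_pos
    (hDC : Language.orderedExpRing.IsDefinablyComplete K) (P : ℕ → K[X]) (n : ℕ) :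
    IsFiniteUnionOfIntervals {x : K | 0 < UnaryExpPoly.eval exp P n x} := by
  by_cases hP : ∃ j < n, P j ≠ 0
  · letI : TopologicalSpace K := Preorder.topology K
    haveI : OrderTopology K := ⟨rfl⟩
    have hcont : Continuous fun y : K => UnaryExpPoly.eval exp P n y :=
      continuous_iff_continuousAt.2 fun x =>
        (isOrderedExp_exp.hasFieldDerivAt_unaryExpPoly P n x).continuousAt
    exact hDC.isFiniteUnionOfIntervals_setOf_pos (definable_lt K) definable_graph_add
      (definable_graph_unaryExpPoly K P n) hcont (finite_setOf_unaryExpPoly_eq_zero K hDC P n hP).1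
  · push Not at hP
    have hempty : {x : K | 0 < UnaryExpPoly.eval exp P n x} = ∅ := by
      ext x
      simp [unaryExpPoly_eq_zero_of_forall K hP x]
    rw [hempty]
    exact isFiniteUnionOfIntervals_empty

/-- `{x | Σ_j P_j(x) exp(x)^j = 0}` is a finite union of intervals (finite, or everything) in
every definably complete model of `OEF`. [cite: FornasieroServi2010, Theorem 8.2] -/
theorem isFiniteUnionOfIntervals_setOf_unaryExpPoly_eq_zero
    (hDC : Language.orderedExpRing.IsDefinablyComplete K) (P : ℕ → K[X]) (n : ℕ) :
    IsFiniteUnionOfIntervals {x : K | UnaryExpPoly.eval exp P n x = 0} := by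
  by_cases hP : ∃ j < n, P j ≠ 0
  · exact IsFiniteUnionOfIntervals.of_finite (finite_setOf_unaryExpPoly_eq_zero K hDC P n hP).1
  · push Not at hP
    have huniv : {x : K | UnaryExpPoly.eval exp P n x = 0} = univ := by
      ext x
      simp [unaryExpPoly_eq_zero_of_forall K hP x]
    rw [huniv]
    exact isFiniteUnionOfIntervals_univ

/-- `{x | Σ_j P_j(x) exp(x)^j ≥ 0}` is a finite union of intervals in every definably complete
model of `OEF`. [cite: FornasieroServi2010, Theorem 8.2] -/
theorem isFiniteUnionOfIntervals_setOf_unaryExpPoly_nonneg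
    (hDC : Language.orderedExpRing.IsDefinablyComplete K) (P : ℕ → K[X]) (n : ℕ) :
    IsFiniteUnionOfIntervals {x : K | 0 ≤ UnaryExpPoly.eval exp P n x} := by
  have h := (isFiniteUnionOfIntervals_setOf_unaryExpPoly_pos K hDC P n).union
    (isFiniteUnionOfIntervals_setOf_unaryExpPoly_eq_zero K hDC P n)
  refine (congrArg _ ?_).mpr h
  ext x
  simp only [mem_setOf_eq, mem_union]
  constructor
  · intro hx
    rcases hx.lt_or_eq with h' | h'
    · exact Or.inl h'
    · exact Or.inr h'.symm
  · rintro (h' | h')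
    · exact h'.le
    · exact h'.ge

end OEFModel

/-! ### … and in the models of `OEFDC` -/

namespace OEFDCModel

variable (M : Language.Theory.ModelType.{0, 0, w} Theory.OEFDC)

/-- **In every model of `OEFDC = OEF ∪ [DC]`, `{x | Σ_j P_j(x) exp(x)^j > 0}` is a finite union
of intervals.** [cite: FornasieroServi2010, Theorem 8.2] -/
theorem isFiniteUnionOfIntervals_setOf_unaryExpPoly_pos (P : ℕ → (toOEF M)[X]) (n : ℕ) :
    IsFiniteUnionOfIntervals {x : toOEF M | 0 < UnaryExpPoly.eval OEFModel.exp P n x} :=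
  OEFModel.isFiniteUnionOfIntervals_setOf_unaryExpPoly_pos (toOEF M) (isDefinablyComplete M) P n

/-- In every model of `OEFDC`, `{x | Σ_j P_j(x) exp(x)^j = 0}` is a finite union of intervals.
[cite: FornasieroServi2010, Theorem 8.2] -/
theorem isFiniteUnionOfIntervals_setOf_unaryExpPoly_eq_zero (P : ℕ → (toOEF M)[X]) (n : ℕ) :
    IsFiniteUnionOfIntervals {x : toOEF M | UnaryExpPoly.eval OEFModel.exp P n x = 0} :=
  OEFModel.isFiniteUnionOfIntervals_setOf_unaryExpPoly_eq_zero (toOEF M) (isDefinablyComplete M) P n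

/-- In every model of `OEFDC`, `{x | Σ_j P_j(x) exp(x)^j ≥ 0}` is a finite union of intervals.
[cite: FornasieroServi2010, Theorem 8.2] -/
theorem isFiniteUnionOfIntervals_setOf_unaryExpPoly_nonneg (P : ℕ → (toOEF M)[X]) (n : ℕ) :
    IsFiniteUnionOfIntervals {x : toOEF M | 0 ≤ UnaryExpPoly.eval OEFModel.exp P n x} :=
  OEFModel.isFiniteUnionOfIntervals_setOf_unaryExpPoly_nonneg (toOEF M) (isDefinablyComplete M) P n

end OEFDCModel

end Literature.ModelTheory.ExponentialFields
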